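import Literature.NumberTheory.EllipticCurves.YanZhu2026.GreenbergDivisibilityProofs
import Literature.NumberTheory.EllipticCurves.BurungaleCastellaSkinner2025.GreenbergMuInvariantGoodReduction
import Literature.NumberTheory.EllipticCurves.BurungaleSkinnerTianWan2024.SignedTwoVariableDescentPackagePRE
import Literature.NumberTheory.EllipticCurves.NonEisensteinPrimeOfSurjective
import Summits.BirchSwinnertonDyer.Rank1Residual.Partition.IrreducibleOverQuadraticField
import HarnessLib

/-!
# The anticyclotomic Eisenstein crux `AnticyclotomicEisensteinDivisibility` (stmt-BirchSwinnertonDyer-20727)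
# follows from the TWO-variable Greenberg lower half "away from the cyclotomic line" — the text of the
# tenure planner's penned R3 child `GreenbergLowerHalfConj912` (HOME/bsd-wall-ss/rev15-R3/A.sig; BSTW24
# statement 9.12 (b), lower half) — by the crux's OWN antecedent `μ(G⁻) = 0` (BCS25 Prop. 4.2.2 v2)

Lead prover sbc-p1 g6 (2026-08-27), line `bdpline` on 20727; a kernel-checked edge for the planner's
implication web. The R3 text grants, for every good `p ≠ 2`, every Heegner-free imaginary quadratic datum
and EVERY Katz/Greenberg frame with genuine period data, a NON-ZERO cyclotomic witness `s ∈ 𝒪_{ℂ_p}⟦T₁⟧`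
with `(s)·ch(X_Gr(E/K_∞))^ur ⊆ (G)` (the printed "in `Λ^ur ⊗ Frac(Λ^{cyc,ur})`" shape of BSTW24 Thm. 9.24 /
statement 9.12). Such a statement does NOT specialise to the anticyclotomic line by itself (`s(0)` may
vanish) — but the crux's antecedent conjunct `prop422_greenbergAnyRoot_hasUnitContent_minus` gives
`μ(G⁻) = 0`, and the tree's Weierstrass-division cancellation
`le_span_of_span_map_C_mul_le_of_hasUnitContent_minus` (Yan–Zhu's "de-localisation", as in sbc-p2's
`stub_delocalise`) removes the witness: `ch^ur ⊆ (G)` in two variables, whence the crux by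
`Ideal.map constantCoeff` (`(G).map constantCoeff = (G⁻)`). So, GIVEN the route's published inputs,
20727 is IMPLIED BY the R3 crux text (conjecture-grade at supersingular `p` with additive conductor:
BSTW24 Thm. 9.24 needs `N` square-free and (spl); refereed at ordinary `p` — the slack-free ordinary
instance is `SignedBaseChangeAcDivOrdinary.charIdealXGr₂_map_le_span_of_goodOrd`, p550979).
The R3 text is a HYPOTHESIS here (no such item exists: R3 was penned, not applied); nothing asserted;
no new definitions; the route file is not imported (texts restated verbatim).
-/

-- D-0017: single-problem summit, the namespace repeats the problem name by design.
set_option linter.dupNamespace false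
set_option autoImplicit false

noncomputable section

open scoped Classical

namespace Summit.BirchSwinnertonDyer.BirchSwinnertonDyer.Theorems.SignedBaseChangeAcDivOfLowerHalf

open NumberField IsDedekindDomain Field CongruenceSubgroup
  Literature.NumberTheory.EllipticCurves Literature.NumberTheory.EllipticCurves.YanZhu2026
  Literature.NumberTheory.EllipticCurves.UnrSeries₂

/-- **R3 ⟹ AC child.** The text of the penned R3 crux `GreenbergLowerHalfConj912`
(HOME/bsd-wall-ss/rev15-R3/A.sig, VERBATIM: two-variable Greenberg Eisenstein inclusion up to a non-zero
cyclotomic witness, every good `p ≠ 2`, every frame with genuine period data) implies the text of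
stmt-BirchSwinnertonDyer-20727 VERBATIM: cancel the witness against `μ(G⁻) = 0` (antecedent conjunct 1,
BCS25 Prop. 4.2.2 v2, with (irr_K) from (sur)), then apply `Ideal.map constantCoeff`.
[cite: BurungaleSkinnerTianWan2024, statement 9.12 (b) and Thm. 9.24 (arXiv:2409.01350v2, §9.4.2) (shape of the hypothesis; nothing asserted)]
[cite: BurungaleCastellaSkinner2025, Prop. 4.2.2 (arXiv:2405.00270v2 p. 9) (the μ = 0 input, an antecedent here)]
[cite: YanZhu2024MainConjNonCM, proof of Thm. 4.2 (2) (arXiv:2412.20078v4 TeX l.1042–1050) (the cancellation)] -/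
theorem acDivChild_of_greenbergLowerHalf
    (hA : ∀ (p : ℕ) [Fact p.Prime] (W : WeierstrassCurve ℚ) [W.IsElliptic] [W.IsGloballyMinimal] (K : Type) [Field K] [NumberField K] (ι : PadicAlgCl p ≃+* ℂ) (v vbar : IsDedekindDomain.HeightOneSpectrum (NumberField.RingOfIntegers K)) (κ₁ κ₂ : Literature.NumberTheory.EllipticCurves.ZpExtension K p) (γ₁ γ₂ : Field.absoluteGaloisGroup K) [Fact (Literature.NumberTheory.EllipticCurves.ZpExtension.IsTopGeneratorPair κ₁ κ₂ γ₁ γ₂)] [NeZero (NumberField.discr K).natAbs] (N : ℕ) [NeZero N] (f : CuspForm (CongruenceSubgroup.Gamma0 N) 2), Literature.NumberTheory.EllipticCurves.ModularForms.IsNewformOf W f → (N : ℤ) = W.conductorNorm ℤ → p ≠ 2 → ¬ p ∣ N → Literature.NumberTheory.EllipticCurves.IsImaginaryQuadratic K → ((Ideal.span {(p : ℤ)}).primesOver (NumberField.RingOfIntegers K)).ncard = 2 → ((p : ℕ) : NumberField.RingOfIntegers K) ∈ v.asIdeal → ((p : ℕ) : NumberField.RingOfIntegers K) ∈ vbar.asIdeal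 → vbar ≠ v → (∀ (w : NumberField.InfinitePlace K) (k : NumberField.RingOfIntegers K), k ∈ v.asIdeal ↔ ‖ι.symm (w.embedding (k : K))‖ < 1) → IsCoprime (N : ℤ) (NumberField.discr K) → κ₁.IsCyclotomic → κ₂.IsAnticyclotomic → ∀ (Ω δ : ℂ) (Ωp : (Literature.NumberTheory.EllipticCurves.unrIntegers p)ˣ) (LK G : PowerSeries (PowerSeries (PadicComplexInt p))), Ω ≠ 0 → (δ ^ 2 = (NumberField.discr K : ℂ) ∨ δ ^ 2 = -(NumberField.discr K : ℂ)) → Literature.NumberTheory.EllipticCurves.IsKatzMeasure₂ ι v vbar ∅ κ₁ κ₂ γ₁⁻¹ γ₂⁻¹ 1 Ω δ ((Ωp : Literature.NumberTheory.EllipticCurves.unrIntegers p) : PadicComplex p) LK → Literature.NumberTheory.EllipticCurves.IsGreenbergLFunctionAnyRoot₂ ι v vbar κ₁ κ₂ γ₁⁻¹ γ₂⁻¹ f (NumberField.discr K).natAbs (NumberField.classNumber K) LK G → ∀ J : ℤ_[p] →+* PadicComplexInt p, (∀ x : ℤ_[p], ((J x : PadicComplexInt p) : PadicComplex p) = ((x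 : ℚ_[p]) : PadicComplex p)) → ∃ s : PowerSeries (PadicComplexInt p), s ≠ 0 ∧ Ideal.span {PowerSeries.map (PowerSeries.C (R := PadicComplexInt p)) s} * (WeierstrassCurve.XGr₂.charIdeal (W.baseChange K) p κ₁ κ₂ vbar γ₁ γ₂).map (Literature.NumberTheory.EllipticCurves.IwasawaAlgebra₂.toUnr₂ p J) ≤ Ideal.span {G}) :
    (Literature.NumberTheory.EllipticCurves.BurungaleCastellaSkinner2025.prop422_greenbergAnyRoot_hasUnitContent_minus ∧ Literature.NumberTheory.EllipticCurves.BurungaleSkinnerTianWan2024.props118_27_519_exists_signedTwoVariablePackage_supersingular_PRE) → Literature.NumberTheory.EllipticCurves.ModularForms.nonempty_modularParametrizationData → ∀ (W : WeierstrassCurve ℚ) [W.IsElliptic] [W.IsGloballyMinimal] (p : ℕ) [Fact p.Prime], 5 ≤ p → W.HasGoodReductionAtPrime p → Literature.NumberTheory.EllipticCurves.Rank1Residual.Surj W p → ∀ (K : Type) [Field K] [NumberField K] (ι : PadicAlgCl p ≃+* ℂ) (v vbar : IsDedekindDomain.HeightOneSpectrum (NumberField.RingOfIntegers K)) (κ₁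 κ₂ : Literature.NumberTheory.EllipticCurves.ZpExtension K p) (γ₁ γ₂ : Field.absoluteGaloisGroup K) [Fact (Literature.NumberTheory.EllipticCurves.ZpExtension.IsTopGeneratorPair κ₁ κ₂ γ₁ γ₂)] [NeZero (NumberField.discr K).natAbs] (N : ℕ) [NeZero N] (f : CuspForm (CongruenceSubgroup.Gamma0 N) 2), Literature.NumberTheory.EllipticCurves.ModularForms.IsNewformOf W f → (N : ℤ) = W.conductorNorm ℤ → Literature.NumberTheory.EllipticCurves.IsImaginaryQuadratic K → ((Ideal.span {(p : ℤ)}).primesOver (NumberField.RingOfIntegers K)).ncard = 2 → ((p : ℕ) : NumberField.RingOfIntegers K) ∈ v.asIdeal → ((p : ℕ) : NumberField.RingOfIntegers K) ∈ vbar.asIdeal → vbar ≠ v → (∀ (w : NumberField.InfinitePlace K) (k : NumberField.RingOfIntegers K), k ∈ v.asIdeal ↔ ‖ι.symm (w.embedding (k : K))‖ < 1) → IsCoprime (N : ℤ) (NumberField.discr K) → (∀ ℓ : ℕ, ℓ.Prime → ℓ ∣ N → ((Ideal.span {(ℓ : ℤ)}).primesOver (NumberField.RingOfIntegers K)).ncard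 = 2) → Odd (NumberField.discr K) → NumberField.discr K ≠ -3 → κ₁.IsCyclotomic → κ₂.IsAnticyclotomic → ∀ (Ω δ : ℂ) (Ωp : (Literature.NumberTheory.EllipticCurves.unrIntegers p)ˣ) (LK G : PowerSeries (PowerSeries (PadicComplexInt p))), Ω ≠ 0 → (δ ^ 2 = (NumberField.discr K : ℂ) ∨ δ ^ 2 = -(NumberField.discr K : ℂ)) → Literature.NumberTheory.EllipticCurves.IsKatzMeasure₂ ι v vbar ∅ κ₁ κ₂ γ₁⁻¹ γ₂⁻¹ 1 Ω δ ((Ωp : Literature.NumberTheory.EllipticCurves.unrIntegers p) : PadicComplex p) LK → Literature.NumberTheory.EllipticCurves.IsGreenbergLFunctionAnyRoot₂ ι v vbar κ₁ κ₂ γ₁⁻¹ γ₂⁻¹ f (NumberField.discr K).natAbs (NumberField.classNumber K) LK G → ∀ J : ℤ_[p] →+* PadicComplexInt p, (∀ x : ℤ_[p], ((J x : PadicComplexInt p) : PadicComplex p) = ((x : ℚ_[p]) : PadicComplex p)) → ((WeierstrassCurve.XGr₂.charIdeal (W.baseChange K) p κ₁ κ₂ vbar γ₁ γ₂).map (Literature.NumberTheory.EllipticCurves.IwasawaAlgebra₂.toUnr₂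 p J)).map (PowerSeries.constantCoeff (R := PowerSeries (PadicComplexInt p))) ≤ Ideal.span {Literature.NumberTheory.EllipticCurves.UnrSeries₂.minus G} := by
  intro hIn _ W _ _ p _ hp hgood hs K _ _ ι v vbar κ₁ κ₂ γ₁ γ₂ _ _ N _ f hf hN hK hsplit hv hvbar hvv hι hcop hHeeg
    hodd hne3 hκ₁ hκ₂ Ω δ Ωp LK G hΩ hδ hLK hG J hJ
  have hp2 : p ≠ 2 := by omega
  have hNn : N = W.conductorNorm ℤ := by exact_mod_cast hN
  have hpN : ¬ p ∣ N := hNn ▸ not_dvd_conductorNorm_of_hasGoodReductionAtPrime W hgood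
  -- the R3 text: a non-zero cyclotomic witness
  obtain ⟨s, hs0, hle⟩ := hA p W K ι v vbar κ₁ κ₂ γ₁ γ₂ N f hf hN hp2 hpN hK hsplit hv hvbar hvv hι hcop hκ₁ hκ₂
    Ω δ Ωp LK G hΩ hδ hLK hG J hJ
  -- μ(G⁻) = 0 from the crux's own antecedent (BCS25 Prop. 4.2.2 v2), (irr_K) from (sur)
  have hirr : (W.baseChange K).HasIrreducibleModPGaloisRep p :=
    Summit.BirchSwinnertonDyer.Rank1Residual.irrK_of_surj W p hs K hK.1
  have hμ : GreenbergVatsal2000.HasUnitContent (minus G) :=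
    hIn.1 ι W K v vbar κ₁ κ₂ γ₁ γ₂ hf hN (by omega) hgood hK hHeeg hsplit hodd hne3 hcop hirr hv hvbar hvv hι
      hκ₁ hκ₂ Ω δ Ωp LK G hΩ hδ hLK hG
  -- cancel the witness (Weierstrass division), then specialise to the anticyclotomic line
  have hle' := le_span_of_span_map_C_mul_le_of_hasUnitContent_minus hμ hs0 hle
  refine (Ideal.map_mono hle').trans (le_of_eq ?_)
  rw [Ideal.map_span, Set.image_singleton]
  rfl

end Summit.BirchSwinnertonDyer.BirchSwinnertonDyer.Theorems.SignedBaseChangeAcDivOfLowerHalf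

end
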